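import Summits.AtomisticToContinuum.FouriersLaw.Theses.PhononMeanFreePath
import Summits.AtomisticToContinuum.FouriersLaw.Theorems.PhononMeanFreePathCoherentDephasingWeakCouplingCorrelationDecay
import Summits.AtomisticToContinuum.FouriersLaw.Theorems.CoherentDephasing.Negative.ScalingNormalForm

/-!
# CoherentDephasingWeakCoupling — the integrability clause for every chain length, the reduction of the
item to its limit clause, and the transfer from geometric extinction

Support file for the items `PhononMeanFreePath.CoherentDephasingWeakCoupling`
(stmt-AtomisticToContinuum-11813) and `PhononMeanFreePath.CoherentDephasing`
(stmt-AtomisticToContinuum-11810). Both are typed as a conjunction, at every admissible parameter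
point `(ω₂, lam, β, γ, T)`, of

* (I) `∀ N, t ↦ r_N(t)² ∈ L¹(0, ∞)`, and
* (L) `N · ∫₀^∞ r_N(t)² dt → 0`,

where `r_N(t) = ∫ p₀ · (K_t p_N) dμ_T` is the Gibbs- and noise-averaged end-to-end momentum pair
correlation of the `(N+1)`-site chain `pinnedChain ω₂ lam β γ` with both Langevin baths at temperature
`T`. From the general fixed-length decorrelation estimates of
`PhononMeanFreePathCoherentDephasingWeakCouplingCorrelationDecay.lean`:

* `pinnedChain_pairCorr_exp_decay`, `pinnedChain_pairCorr_sq_integrableOn` — `|⟨p_i, K_u p_j⟩_{μ_T}| ≤ C e^{-cu}`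
  at fixed length, hence (I) for every `N` and ALL `ω₂, β, γ, T > 0`, `lam ≥ 0`
  (`pairCorr_sq_integrableOn`);
* `abs_pairCorr_le_temp` — the only length-uniform estimate here, `|⟨p_i, K_u p_j⟩_{μ_T}| ≤ T`
  (Cauchy–Schwarz, `L²(μ_T)`-contraction of `K_u`, `∫ p² dμ_T = T`);
* `coherentDephasingWeakCoupling_iff_limit`, `coherentDephasing_iff_limit` — **both items are
  equivalent to their limit clause (L) alone**;
* `coherentDephasingWeakCoupling_of_corner_majorant`, `coherentDephasingWeakCoupling_of_corner_extinction`
  — with the unit-temperature corner normal form (`coherentDephasingWeakCoupling_iff_corner`), the item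
  follows from any `o(1/N)` majorant of `∫₀^∞ r_N(t; a, b, 1)² dt` on `0 < a, b ≤ ε₀(ω₂, γ)`, in
  particular from a geometric (Beer–Lambert) bound `≤ C ρ^N`, `ρ < 1` — the "finite thermal phonon
  mean free path at fixed small coupling" estimate, which is NOT proved here and is the entire
  remaining content of the item.

## References

* N. Cuneo, J.-P. Eckmann, M. Hairer, L. Rey-Bellet, *Non-equilibrium steady states for networks
  of oscillators*, Electron. J. Probab. 23 (2018) no. 55, Thm 2.13 (3).
-/

noncomputable section

open MeasureTheory ProbabilityTheory Filter Topology Set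
open scoped NNReal ENNReal

namespace Summit.AtomisticToContinuum.FouriersLaw.Theorems.CoherentDephasing

open Literature.MathematicalPhysics.KineticTheory.HeatConduction
open Literature.MathematicalPhysics.KineticTheory Literature.Probability.Process OscillatorChain
open Summit.AtomisticToContinuum.FouriersLaw.Theorems.SubdiffusiveBondHeat

/-! ### The momentum pair correlation `⟨p_i, K_u p_j⟩_{μ_T}` of an `n`-site chain -/

section Pair

variable {ω₂ lam β γ : ℝ} (hω : 0 < ω₂) (hl : 0 ≤ lam) (hβ : 0 < β) (hγ : 0 < γ) {n : ℕ} (hn : 0 < n)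
  {T : ℝ} (hT : 0 < T)
include hω hl hβ hγ hn hT

/-- **Exponential decay of the momentum pair correlation at fixed length**: for the `n`-site pinned
chain (`ω₂, β, γ, T > 0`, `lam ≥ 0`, `n ≥ 1`) and any sites `i, j` there are `C` and `c > 0` with
`|∫ p_i · (K_u p_j) dμ_T| ≤ C e^{-cu}` for all `u ≥ 0` (`pinnedChain_corr_exp_decay` with
`a = p_i`, `g = p_j`, `ϑ = 1/(4T)`, and `μ_T(p_j) = 0`). The constants depend on `n`.
[cite: CuneoEckmannHairerReyBellet2018, Thm 2.13 (3)] -/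
theorem pinnedChain_pairCorr_exp_decay (i j : Fin n) :
    ∃ C c : ℝ, 0 < c ∧ ∀ u : ℝ, 0 ≤ u →
      |∫ z, z.2 i * (∫ y, y.2 j ∂((pinnedChain ω₂ lam β γ).transitionKernel n T T u.toNNReal z))
        ∂((pinnedChain ω₂ lam β γ).gibbsMeasure n T)| ≤ C * Real.exp (-c * u) := by
  have hϑ0 : 0 < 1 / (4 * T) := by positivity
  have h2ϑ : 2 * (1 / (4 * T)) < 1 / T := by
    rw [show 2 * (1 / (4 * T)) = 1 / (2 * T) by field_simp; ring, div_lt_div_iff₀ (by positivity) hT]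
    nlinarith
  obtain ⟨C, c, hc, h⟩ := pinnedChain_corr_exp_decay hω hl hβ hγ hn hT hϑ0 h2ϑ
    (a := fun z : PhaseSpace n => z.2 i) (g := fun z : PhaseSpace n => z.2 j) (by fun_prop) (by fun_prop)
    (fun y => abs_momentum_le_exp hω.le hl hβ.le hϑ0 y i) (fun y => abs_momentum_le_exp hω.le hl hβ.le hϑ0 y j)
  refine ⟨C, c, hc, fun u hu => ?_⟩
  have h' := h u hu
  rwa [pinnedChain_integral_momentum_gibbsMeasure n T j, mul_zero, sub_zero] at h'

/-- **Uniform a-priori bound `|⟨p_i, K_u p_j⟩_{μ_T}| ≤ T`** for every length `n ≥ 1`, all sites and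
all `u ≥ 0`: Cauchy–Schwarz in `L²(μ_T)` (as weighted AM–GM), the `L²(μ_T)`-contraction
`∫ (K_u p_j)² dμ_T ≤ ∫ p_j² dμ_T` (Jensen + Gibbs invariance of the kernels) and
`∫ p_i² dμ_T = ∫ p_j² dμ_T = T`. [folklore] -/
theorem abs_pairCorr_le_temp (i j : Fin n) (u : ℝ≥0) :
    |∫ z, z.2 i * (∫ y, y.2 j ∂((pinnedChain ω₂ lam β γ).transitionKernel n T T u z))
        ∂((pinnedChain ω₂ lam β γ).gibbsMeasure n T)| ≤ T := by
  set P := pinnedChain ω₂ lam β γ with hP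
  set μ := P.gibbsMeasure n T with hμ
  have hϑ0 : 0 < 1 / (4 * T) := by positivity
  have h2ϑ : 2 * (1 / (4 * T)) < 1 / T := by
    rw [show 2 * (1 / (4 * T)) = 1 / (2 * T) by field_simp; ring, div_lt_div_iff₀ (by positivity) hT]
    nlinarith
  have hbc : Continuous fun z : PhaseSpace n => z.2 j := by fun_prop
  obtain ⟨-, hg2, hle⟩ := pinnedChain_integral_sq_act_le hω hl hβ hγ hn hT hϑ0 h2ϑ hbc
    (fun y => abs_momentum_le_exp hω.le hl hβ.le hϑ0 y j) u
  have hac : Continuous fun z : PhaseSpace n => z.2 i := by fun_prop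
  obtain ⟨ha2, -, -⟩ := pinnedChain_integral_sq_act_le hω hl hβ hγ hn hT hϑ0 h2ϑ hac
    (fun y => abs_momentum_le_exp hω.le hl hβ.le hϑ0 y i) u
  have hi : ∫ z, z.2 i ^ 2 ∂μ = T := pinnedChain_integral_momentum_sq_gibbsMeasure hω hl hβ.le n hT i
  have hj : ∫ z, z.2 j ^ 2 ∂μ = T := pinnedChain_integral_momentum_sq_gibbsMeasure hω hl hβ.le n hT j
  have h := abs_integral_mul_le_weighted (μ := μ) ha2 hg2 one_pos
  rw [one_mul, inv_one, one_mul, hi] at h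
  linarith [hle.trans_eq hj]

omit hn in
/-- The pair correlation `u ↦ ⟨p_i, K_{u⁺} p_j⟩_{μ_T}` is a measurable function of time. [folklore] -/
theorem pinnedChain_measurable_pairCorr (i j : Fin n) :
    Measurable fun u : ℝ => ∫ z, z.2 i *
        (∫ y, y.2 j ∂((pinnedChain ω₂ lam β γ).transitionKernel n T T u.toNNReal z))
      ∂((pinnedChain ω₂ lam β γ).gibbsMeasure n T) :=
  pinnedChain_measurable_corr hω hl hβ hγ hT (a := fun z : PhaseSpace n => z.2 i)
    (g := fun z : PhaseSpace n => z.2 j) (by fun_prop) (by fun_prop)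

/-- **The square of the momentum pair correlation is integrable on `(0, ∞)`** at every fixed length.
[folklore] -/
theorem pinnedChain_pairCorr_sq_integrableOn (i j : Fin n) :
    IntegrableOn (fun u : ℝ => (∫ z, z.2 i *
        (∫ y, y.2 j ∂((pinnedChain ω₂ lam β γ).transitionKernel n T T u.toNNReal z))
      ∂((pinnedChain ω₂ lam β γ).gibbsMeasure n T)) ^ 2) (Ioi 0) := by
  have hϑ0 : 0 < 1 / (4 * T) := by positivity
  have h2ϑ : 2 * (1 / (4 * T)) < 1 / T := by
    rw [show 2 * (1 / (4 * T)) = 1 / (2 * T) by field_simp; ring, div_lt_div_iff₀ (by positivity) hT]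
    nlinarith
  exact pinnedChain_corr_sq_integrableOn hω hl hβ hγ hn hT hϑ0 h2ϑ
    (a := fun z : PhaseSpace n => z.2 i) (g := fun z : PhaseSpace n => z.2 j) (by fun_prop) (by fun_prop)
    (fun y => abs_momentum_le_exp hω.le hl hβ.le hϑ0 y i) (fun y => abs_momentum_le_exp hω.le hl hβ.le hϑ0 y j)
    (pinnedChain_integral_momentum_gibbsMeasure n T j)

/-- The momentum pair correlation itself is integrable on `(0, ∞)` at every fixed length. [folklore] -/
theorem pinnedChain_pairCorr_integrableOn (i j : Fin n) :
    IntegrableOn (fun u : ℝ => ∫ z, z.2 i *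
        (∫ y, y.2 j ∂((pinnedChain ω₂ lam β γ).transitionKernel n T T u.toNNReal z))
      ∂((pinnedChain ω₂ lam β γ).gibbsMeasure n T)) (Ioi 0) := by
  have hϑ0 : 0 < 1 / (4 * T) := by positivity
  have h2ϑ : 2 * (1 / (4 * T)) < 1 / T := by
    rw [show 2 * (1 / (4 * T)) = 1 / (2 * T) by field_simp; ring, div_lt_div_iff₀ (by positivity) hT]
    nlinarith
  exact pinnedChain_corr_integrableOn hω hl hβ hγ hn hT hϑ0 h2ϑ
    (a := fun z : PhaseSpace n => z.2 i) (g := fun z : PhaseSpace n => z.2 j) (by fun_prop) (by fun_prop)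
    (fun y => abs_momentum_le_exp hω.le hl hβ.le hϑ0 y i) (fun y => abs_momentum_le_exp hω.le hl hβ.le hϑ0 y j)
    (pinnedChain_integral_momentum_gibbsMeasure n T j)

end Pair

/-! ### The two items: clause (I) proved, reduction to the limit clause, transfer lemmas -/

section Items

open Summit.AtomisticToContinuum.FouriersLaw.Theses.PhononMeanFreePath
open Summit.AtomisticToContinuum.FouriersLaw.Theorems.CoherentDephasing.Negative.ScalingNormalForm

/-- **Clause (I) of `CoherentDephasing` / `CoherentDephasingWeakCoupling`, proved for every length**:
for `ω₂, β, γ, T > 0`, `lam ≥ 0` and every `N`, `t ↦ r_N(t)²` is integrable on `(0, ∞)`, where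
`r_N(t) = ∫ p₀ (K_t p_N) dμ_T` for the `(N+1)`-site chain. [folklore] -/
theorem pairCorr_sq_integrableOn {ω₂ lam β γ : ℝ} (hω : 0 < ω₂) (hl : 0 ≤ lam) (hβ : 0 < β)
    (hγ : 0 < γ) {T : ℝ} (hT : 0 < T) (N : ℕ) :
    IntegrableOn (fun t : ℝ => (∫ z, z.2 0 * (∫ y, y.2 (Fin.last N)
        ∂((pinnedChain ω₂ lam β γ).transitionKernel (N + 1) T T t.toNNReal z))
        ∂((pinnedChain ω₂ lam β γ).gibbsMeasure (N + 1) T)) ^ 2) (Ioi 0) :=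
  pinnedChain_pairCorr_sq_integrableOn hω hl hβ hγ (Nat.succ_pos N) hT 0 (Fin.last N)

/-- **`sup_{N, t} |r_N(t)| ≤ T`**: the crux's pair correlation is bounded by the temperature,
uniformly in the length and in time. [folklore] -/
theorem abs_pairCorr_last_le_temp {ω₂ lam β γ : ℝ} (hω : 0 < ω₂) (hl : 0 ≤ lam) (hβ : 0 < β)
    (hγ : 0 < γ) {T : ℝ} (hT : 0 < T) (N : ℕ) (t : ℝ) :
    |∫ z, z.2 0 * (∫ y, y.2 (Fin.last N)
        ∂((pinnedChain ω₂ lam β γ).transitionKernel (N + 1) T T t.toNNReal z))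
        ∂((pinnedChain ω₂ lam β γ).gibbsMeasure (N + 1) T)| ≤ T :=
  abs_pairCorr_le_temp hω hl hβ hγ (Nat.succ_pos N) hT 0 (Fin.last N) t.toNNReal

/-- **The weak-coupling item reduces to its limit clause**: `CoherentDephasingWeakCoupling` is
equivalent to the statement with the integrability conjunct deleted (it holds unconditionally by
`pairCorr_sq_integrableOn`). What remains is exactly `N ∫₀^∞ r_N² → 0` in the corner
`lam T, β T ≤ ε₀(ω₂, γ)`. [folklore] -/
theorem coherentDephasingWeakCoupling_iff_limit :
    CoherentDephasingWeakCoupling ↔ ∀ ω₂ γ : ℝ, 0 < ω₂ → 0 < γ → ∃ ε₀ : ℝ, 0 < ε₀ ∧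
      ∀ lam β T : ℝ, 0 < lam → 0 < β → 0 < T → lam * T ≤ ε₀ → β * T ≤ ε₀ →
        Tendsto (fun N : ℕ => (N : ℝ) * ∫ t in Ioi (0 : ℝ), (∫ z, z.2 0 * (∫ y, y.2 (Fin.last N)
          ∂((pinnedChain ω₂ lam β γ).transitionKernel (N + 1) T T t.toNNReal z))
          ∂((pinnedChain ω₂ lam β γ).gibbsMeasure (N + 1) T)) ^ 2) atTop (𝓝 0) := by
  constructor
  · intro h ω₂ γ hω hγ
    obtain ⟨ε₀, hε, hc⟩ := h ω₂ γ hω hγ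
    exact ⟨ε₀, hε, fun lam β T hl hβ hT hlT hβT => (hc lam β T hl hβ hT hlT hβT).2⟩
  · intro h ω₂ γ hω hγ
    obtain ⟨ε₀, hε, hc⟩ := h ω₂ γ hω hγ
    exact ⟨ε₀, hε, fun lam β T hl hβ hT hlT hβT =>
      ⟨pairCorr_sq_integrableOn hω hl.le hβ hγ hT, hc lam β T hl hβ hT hlT hβT⟩⟩

/-- **The crux reduces to its limit clause**: `CoherentDephasing` is equivalent to
`∀ parameters > 0, N ∫₀^∞ r_N² → 0` (the integrability conjunct holds unconditionally). [folklore] -/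
theorem coherentDephasing_iff_limit :
    CoherentDephasing ↔ ∀ ω₂ lam β γ : ℝ, 0 < ω₂ → 0 < lam → 0 < β → 0 < γ → ∀ T : ℝ, 0 < T →
      Tendsto (fun N : ℕ => (N : ℝ) * ∫ t in Ioi (0 : ℝ), (∫ z, z.2 0 * (∫ y, y.2 (Fin.last N)
        ∂((pinnedChain ω₂ lam β γ).transitionKernel (N + 1) T T t.toNNReal z))
        ∂((pinnedChain ω₂ lam β γ).gibbsMeasure (N + 1) T)) ^ 2) atTop (𝓝 0) := by
  constructor
  · intro h ω₂ lam β γ hω hl hβ hγ T hT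
    exact (h ω₂ lam β γ hω hl hβ hγ T hT).2
  · intro h ω₂ lam β γ hω hl hβ hγ T hT
    exact ⟨pairCorr_sq_integrableOn hω hl.le hβ hγ hT, h ω₂ lam β γ hω hl hβ hγ T hT⟩

/-- **The item as a bare limit statement in the unit-temperature corner**: `CoherentDephasingWeakCoupling`
is equivalent to `N ∫₀^∞ r_N(t; a, b, 1)² dt → 0` for all couplings `0 < a, b ≤ ε₀(ω₂, γ)` at `T = 1`
(scaling normal form `coherentDephasingWeakCoupling_iff_corner` + clause (I)). [folklore] -/
theorem coherentDephasingWeakCoupling_iff_corner_limit :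
    CoherentDephasingWeakCoupling ↔ ∀ ω₂ γ : ℝ, 0 < ω₂ → 0 < γ → ∃ ε₀ : ℝ, 0 < ε₀ ∧
      ∀ a b : ℝ, 0 < a → 0 < b → a ≤ ε₀ → b ≤ ε₀ →
        Tendsto (fun N : ℕ => (N : ℝ) * ∫ t in Ioi (0 : ℝ), (∫ z, z.2 0 * (∫ y, y.2 (Fin.last N)
          ∂((pinnedChain ω₂ a b γ).transitionKernel (N + 1) 1 1 t.toNNReal z))
          ∂((pinnedChain ω₂ a b γ).gibbsMeasure (N + 1) 1)) ^ 2) atTop (𝓝 0) := by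
  rw [coherentDephasingWeakCoupling_iff_corner]
  constructor
  · intro h ω₂ γ hω hγ
    obtain ⟨ε₀, hε, hc⟩ := h ω₂ γ hω hγ
    exact ⟨ε₀, hε, fun a b ha hb hae hbe => (hc a b ha hb hae hbe).2⟩
  · intro h ω₂ γ hω hγ
    obtain ⟨ε₀, hε, hc⟩ := h ω₂ γ hω hγ
    exact ⟨ε₀, hε, fun a b ha hb hae hbe =>
      ⟨pairCorr_sq_integrableOn hω ha.le hb hγ one_pos, hc a b ha hb hae hbe⟩⟩

/-- **Transfer from an `o(1/N)` majorant in the unit-temperature corner.** If for every `ω₂, γ > 0`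
there is `ε₀ > 0` such that for all couplings `0 < a, b ≤ ε₀` the coherent channel at `T = 1` admits a
majorant `∫₀^∞ r_N² ≤ s_N` with `N s_N → 0`, then `CoherentDephasingWeakCoupling` holds (integrability is
unconditional; `0 ≤ ∫₀^∞ r_N²`; squeeze; scaling normal form). [folklore] -/
theorem coherentDephasingWeakCoupling_of_corner_majorant
    (h : ∀ ω₂ γ : ℝ, 0 < ω₂ → 0 < γ → ∃ ε₀ : ℝ, 0 < ε₀ ∧ ∀ a b : ℝ, 0 < a → 0 < b → a ≤ ε₀ → b ≤ ε₀ →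
      ∃ s : ℕ → ℝ, Tendsto (fun N : ℕ => (N : ℝ) * s N) atTop (𝓝 0) ∧
        ∀ N : ℕ, ∫ t in Ioi (0 : ℝ), (∫ z, z.2 0 * (∫ y, y.2 (Fin.last N)
          ∂((pinnedChain ω₂ a b γ).transitionKernel (N + 1) 1 1 t.toNNReal z))
          ∂((pinnedChain ω₂ a b γ).gibbsMeasure (N + 1) 1)) ^ 2 ≤ s N) :
    CoherentDephasingWeakCoupling := by
  rw [coherentDephasingWeakCoupling_iff_corner_limit]
  intro ω₂ γ hω hγ
  obtain ⟨ε₀, hε, hc⟩ := h ω₂ γ hω hγ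
  refine ⟨ε₀, hε, fun a b ha hb hae hbe => ?_⟩
  obtain ⟨s, hs, hle⟩ := hc a b ha hb hae hbe
  refine squeeze_zero (fun N => mul_nonneg (Nat.cast_nonneg N)
    (setIntegral_nonneg measurableSet_Ioi fun t _ => sq_nonneg _)) (fun N => ?_) hs
  exact mul_le_mul_of_nonneg_left (hle N) (Nat.cast_nonneg N)

/-- **Transfer from geometric extinction (Beer–Lambert shape).** If for every `ω₂, γ > 0` there is
`ε₀ > 0` such that for all couplings `0 < a, b ≤ ε₀` there are `C` and `0 ≤ ρ < 1` with
`∫₀^∞ r_N(t; a, b, 1)² dt ≤ C ρ^N` for every `N` (a finite thermal phonon mean free path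
`ℓ = -1/log ρ` of the weakly anharmonic chain at unit temperature), then `CoherentDephasingWeakCoupling`
holds (`N ρ^N → 0`). The hypothesis is the open estimate; this lemma only fixes its shape. [folklore] -/
theorem coherentDephasingWeakCoupling_of_corner_extinction
    (h : ∀ ω₂ γ : ℝ, 0 < ω₂ → 0 < γ → ∃ ε₀ : ℝ, 0 < ε₀ ∧ ∀ a b : ℝ, 0 < a → 0 < b → a ≤ ε₀ → b ≤ ε₀ →
      ∃ C ρ : ℝ, 0 ≤ ρ ∧ ρ < 1 ∧
        ∀ N : ℕ, ∫ t in Ioi (0 : ℝ), (∫ z, z.2 0 * (∫ y, y.2 (Fin.last N)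
          ∂((pinnedChain ω₂ a b γ).transitionKernel (N + 1) 1 1 t.toNNReal z))
          ∂((pinnedChain ω₂ a b γ).gibbsMeasure (N + 1) 1)) ^ 2 ≤ C * ρ ^ N) :
    CoherentDephasingWeakCoupling := by
  refine coherentDephasingWeakCoupling_of_corner_majorant fun ω₂ γ hω hγ => ?_
  obtain ⟨ε₀, hε, hc⟩ := h ω₂ γ hω hγ
  refine ⟨ε₀, hε, fun a b ha hb hae hbe => ?_⟩
  obtain ⟨C, ρ, hρ0, hρ1, hle⟩ := hc a b ha hb hae hbe
  refine ⟨fun N => C * ρ ^ N, ?_, hle⟩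
  have ht := (tendsto_self_mul_const_pow_of_lt_one hρ0 hρ1).const_mul C
  rw [mul_zero] at ht
  refine ht.congr fun N => ?_
  ring

end Items

end Summit.AtomisticToContinuum.FouriersLaw.Theorems.CoherentDephasing

end
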